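import Summits.CriticalPhenomena.PercolationContinuityZ3.Theorems.PercFiniteBoxLRORenormaliseFromLinearLROSpineDefs

/-!
# `stub_spineFailure` of line `registered` (crux `PercFiniteBoxLRO.RenormaliseFromLinearLRO`,
# stmt-CriticalPhenomena-0857, reshape 3): the union bound for the failure of a SPINE block

Registered stub `stub_spineFailure` of the lead's skeleton (reshape 3).  The spine block
`spineBox K s m L` (objects file `…SpineDefs.lean`) asks that all the `4L+2` windows `j·eᵢ`
(`i ∈ {0,1}`, `|j| ≤ L`; the centre window is counted once for each `i`) of the planar layer of
spacing `n = (2s+1)m` be dense, i.e. lie in `blockEvent n (denseBox K s m) (Pi.single i j)`.  Hence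

* `(spineBox K s m L)ᶜ = ⋃_{(i, j) ∈ univ ×ˢ Icc (-L) L} (blockEvent n (denseBox K s m) (Pi.single i j))ᶜ`
  (`spineFailure_compl_eq`);
* each complement is the translate `blockEvent n (denseBox K s m)ᶜ (Pi.single i j)` (complement of a
  preimage), of probability `P_p((denseBox K s m)ᶜ)` by translation invariance (`real_blockEvent`);
* the index set has `2·(2L+1) = 4L+2` elements (`spineFailure_card_index`), and the union bound
  `measureReal_biUnion_finset_le` gives `P_p((spineBox K s m L)ᶜ) ≤ (4L+2)·P_p((denseBox K s m)ᶜ)`.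

References: G. Grimmett, *Percolation*, 2nd ed. (1999), §7.4 pp.177–181 (static renormalisation);
the spine block is this line's device.  Pure theorem file, no hypotheses.
-/

noncomputable section

namespace Summit.CriticalPhenomena.PercolationContinuityZ3.Theorems.RenormaliseFromLinearLRO

open Literature.Probability.Percolation Literature.Probability.LatticeModels
open MeasureTheory

/-- The index set of the windows of a spine block: pairs `(i, j)` with `i : Fin 2`, `-L ≤ j ≤ L`. -/
theorem spineFailure_card_index (L : ℕ) :
    ((Finset.univ : Finset (Fin 2)) ×ˢ Finset.Icc (-(L : ℤ)) (L : ℤ)).card = 4 * L + 2 := by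
  rw [Finset.card_product, Finset.card_univ, Fintype.card_fin, Int.card_Icc]
  omega

/-- The failure of the spine block is the union, over its `4L+2` windows, of the failures of the
translated dense blocks. -/
theorem spineFailure_compl_eq (K s m L : ℕ) :
    (spineBox K s m L)ᶜ =
      ⋃ q ∈ (Finset.univ : Finset (Fin 2)) ×ˢ Finset.Icc (-(L : ℤ)) (L : ℤ),
        (blockEvent ((2 * s + 1) * m) (denseBox K s m) (Pi.single q.1 q.2))ᶜ := by
  ext ω
  simp only [Set.mem_iUnion, Set.mem_compl_iff, exists_prop, Finset.mem_product, Finset.mem_univ,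
    true_and, Finset.mem_Icc, Prod.exists, mem_spineBox_iff]
  constructor
  · intro h
    push Not at h
    obtain ⟨i, j, hj, hω⟩ := h
    exact ⟨i, j, abs_le.1 hj, hω⟩
  · rintro ⟨i, j, hj, hω⟩ h
    exact hω (h i j (abs_le.2 hj))

/-- The failure of a translated block event is the translate of the failure of the block event
(complement of a preimage), so it has probability `P_p(Eᶜ)` (translation invariance). -/
theorem spineFailure_real_compl_blockEvent (n : ℕ) (E : Set (BondConfig (Site 3))) (p : unitInterval)
    (a : Site 2) :
    (bondPercolation (zdGraph 3) p).real (blockEvent n E a)ᶜ = (bondPercolation (zdGraph 3) p).real Eᶜ :=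
  real_blockEvent n Eᶜ p a

/-- **Registered stub `stub_spineFailure` of crux stmt-CriticalPhenomena-0857 (line `registered`,
reshape 3)**: the union bound `P_p(spine block fails) ≤ (4L+2) · P_p(dense block fails)` — the spine
block fails only if one of its `4L+2` windows is a non-dense (translated) block, each of probability
`P_p((denseBox K s m)ᶜ)` by translation invariance. -/
theorem stub_spineFailure :
    ∀ (p : unitInterval) (K s m L : ℕ),
      (bondPercolation (zdGraph 3) p).real (spineBox K s m L)ᶜ ≤
        (4 * L + 2) * (bondPercolation (zdGraph 3) p).real (denseBox K s m)ᶜ := by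
  intro p K s m L
  rw [spineFailure_compl_eq K s m L]
  refine (measureReal_biUnion_finset_le _ _).trans (le_of_eq ?_)
  rw [Finset.sum_congr rfl fun q _ =>
      spineFailure_real_compl_blockEvent ((2 * s + 1) * m) (denseBox K s m) p (Pi.single q.1 q.2),
    Finset.sum_const, nsmul_eq_mul, spineFailure_card_index]
  push_cast
  ring

end Summit.CriticalPhenomena.PercolationContinuityZ3.Theorems.RenormaliseFromLinearLRO

end
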